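import Summits.NavierStokesRegularity.NavierStokesRegularity.Theorems.FilamentSkeletonRssSkeletonJ1RMismatchTools
import Literature.Analysis.FluidPDE.DyadicChaining

/-!
# Route `FilamentSkeletonRss` · crux `SkeletonJ1R` (stmt-NavierStokesRegularity-23610) · stub F2 `LiaDefectL` — PARTNER-STRAND BRICK (P1):
# the ambient-vs-actual kernel mismatch of ONE partner with POLYNOMIAL displacement/tilt envelopes (cancellation-free = RATE B)

Lead `ns-fsr-lead-23610` (g2), line `streamline_kantorovich_R` (skeleton of record v5).  Helper file `--supports stmt-NavierStokesRegularity-23610`;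
route-independent (no `Theses` import).  Extends the landed `…SkeletonJ1RMismatchTools.norm_integral_kernelCross_sub_le` (abstract AFFINE displacement
weight `η₀ + η₁|σ|`, constant tilt `η'` — too weak for F2: the partner's tilt saturates at `≍ Rb²` only at the ball's edge, lead g0's F2-notes addendum)
to the σ-DEPENDENT envelopes the LIA reference actually has: displacement `‖x σ − L σ‖ ≤ d₂σ² + d₃|σ|³` and tilt `‖x′σ − t‖ ≤ t₁|σ| + t₂σ²`
(from the linear curvature envelope, shot from the common waist `x 0 = L 0`, `x′0 = t`), together with the global bounds `≤ θ|σ|`, `≤ θ` (`θ ≤ 1/10`).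
`norm_integral_kernelCross_sub_le_of_envelopes`: for a point `y` at perpendicular distance `a > 0` from the line with foot parameter `s`
(`a² + (σ−s)² ≤ ‖y − L σ‖²`), displacement `≤ ‖y − L σ‖/5`, and any `Lk ≥ 2|s|`, `Lk > 0`:
`‖∫ [K_e(‖y−xσ‖)•(x′σ × (y−xσ)) − K_e(‖y−Lσ‖)•(t × (y−Lσ))] dσ‖ ≤ 2Lk·A₀ + π A₁/a + 416πθ/Lk`,
`A₀ = 50d₂/a + 100d₃ + t₁/a + 4t₂`, `A₁ = 50d₂s²/a + 100d₃|s|³/a + 2t₁|s| + 4t₂s²` — only the Cauchy majorant `∫(a²+u²)⁻¹ = π/a` and interval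
lengths are used (no logarithmic integrals), which is what RATE B affords.
HONEST FRAMING: MODEL rung, ∃-side helper lemmas (kernel calculus) toward stub F2 of a HYPOTHETICAL filament-type blow-up skeleton; F2 and the crux
23610 stay OPEN; nothing here bears on Navier–Stokes regularity, which is NOT proved. [folklore]
-/

-- `dupNamespace` off: the module name repeats `NavierStokesRegularity` by the tree's `Summits/<S>/<S>/Theorems` layout (same as every sibling file).
set_option linter.dupNamespace false

noncomputable section

namespace Summit.NavierStokesRegularity.NavierStokesRegularity.Theorems.SkeletonJ1RMismatchTools

open MeasureTheory Filter Topology Set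
open Literature.Analysis.FluidPDE
open scoped RealInnerProductSpace InnerProductSpace BigOperators

/-! ## §1 Pointwise majorants in the two zones -/

/-- Inner-zone algebra (1): `σ²/r³ ≤ 2/a + 2s²/(aψ)` for `ψ = a² + (σ−s)² ≤ r²`, `0 < a`, `0 < r`. [folklore] -/
theorem inner_zone_b1 {a s σ r : ℝ} (ha : 0 < a) (hr : 0 < r) (hψr : a ^ 2 + (σ - s) ^ 2 ≤ r ^ 2) :
    σ ^ 2 / r ^ 3 ≤ 2 / a + 2 * s ^ 2 / a * (a ^ 2 + (σ - s) ^ 2)⁻¹ := by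
  have hψ0 : 0 < a ^ 2 + (σ - s) ^ 2 := by positivity
  have hr3 : 0 < r ^ 3 := by positivity
  have har : a ≤ r := by nlinarith [sq_nonneg (σ - s), sq_nonneg (r - a), sq_nonneg (r + a)]
  have hσ2 : σ ^ 2 ≤ 2 * (σ - s) ^ 2 + 2 * s ^ 2 := by nlinarith [sq_nonneg (σ - 2 * s)]
  have hu2 : (σ - s) ^ 2 ≤ r ^ 2 := by nlinarith [sq_nonneg a]
  have h2 : 2 * (σ - s) ^ 2 / r ^ 3 ≤ 2 / a := by
    rw [div_le_div_iff₀ hr3 ha]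
    have : a * r ^ 2 ≤ r ^ 3 := by nlinarith [mul_le_mul_of_nonneg_right har (sq_nonneg r)]
    nlinarith [mul_le_mul_of_nonneg_left hu2 ha.le]
  have h3 : 2 * s ^ 2 / r ^ 3 ≤ 2 * s ^ 2 / a * (a ^ 2 + (σ - s) ^ 2)⁻¹ := by
    rw [← div_eq_mul_inv, div_div]
    refine div_le_div_of_nonneg_left (by positivity) (by positivity) ?_
    calc a * (a ^ 2 + (σ - s) ^ 2) ≤ r * r ^ 2 := mul_le_mul har hψr hψ0.le hr.le
      _ = r ^ 3 := by ring
  calc σ ^ 2 / r ^ 3 ≤ (2 * (σ - s) ^ 2 + 2 * s ^ 2) / r ^ 3 := div_le_div_of_nonneg_right hσ2 hr3.le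
    _ = 2 * (σ - s) ^ 2 / r ^ 3 + 2 * s ^ 2 / r ^ 3 := by ring
    _ ≤ _ := add_le_add h2 h3

/-- Inner-zone algebra (2): `|σ|³/r³ ≤ 4 + 4|s|³/(aψ)`. [folklore] -/
theorem inner_zone_b2 {a s σ r : ℝ} (ha : 0 < a) (hr : 0 < r) (hψr : a ^ 2 + (σ - s) ^ 2 ≤ r ^ 2) :
    |σ| ^ 3 / r ^ 3 ≤ 4 + 4 * |s| ^ 3 / a * (a ^ 2 + (σ - s) ^ 2)⁻¹ := by
  have hψ0 : 0 < a ^ 2 + (σ - s) ^ 2 := by positivity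
  have hr3 : 0 < r ^ 3 := by positivity
  have hu0 := abs_nonneg (σ - s)
  have hs0 := abs_nonneg s
  have har : a ≤ r := by nlinarith [sq_nonneg (σ - s), sq_nonneg (r - a), sq_nonneg (r + a)]
  have hur : |σ - s| ≤ r := by
    have h1 : |σ - s| ^ 2 ≤ r ^ 2 := by rw [sq_abs]; nlinarith [sq_nonneg a]
    nlinarith [sq_nonneg (r - |σ - s|), sq_nonneg (r + |σ - s|)]
  have hσabs : |σ| ≤ |σ - s| + |s| := by
    calc |σ| = |(σ - s) + s| := by rw [sub_add_cancel]
      _ ≤ |σ - s| + |s| := abs_add_le _ _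
  have hσ3 : |σ| ^ 3 ≤ 4 * |σ - s| ^ 3 + 4 * |s| ^ 3 :=
    (pow_le_pow_left₀ (abs_nonneg σ) hσabs 3).trans (Literature.Analysis.FluidPDE.DyadicChaining.add_pow_three_le_four hu0 hs0)
  have h2 : 4 * |σ - s| ^ 3 / r ^ 3 ≤ 4 := by
    rw [div_le_iff₀ hr3]
    nlinarith [pow_le_pow_left₀ hu0 hur 3]
  have h3 : 4 * |s| ^ 3 / r ^ 3 ≤ 4 * |s| ^ 3 / a * (a ^ 2 + (σ - s) ^ 2)⁻¹ := by
    rw [← div_eq_mul_inv, div_div]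
    refine div_le_div_of_nonneg_left (by positivity) (by positivity) ?_
    calc a * (a ^ 2 + (σ - s) ^ 2) ≤ r * r ^ 2 := mul_le_mul har hψr hψ0.le hr.le
      _ = r ^ 3 := by ring
  calc |σ| ^ 3 / r ^ 3 ≤ (4 * |σ - s| ^ 3 + 4 * |s| ^ 3) / r ^ 3 := div_le_div_of_nonneg_right hσ3 hr3.le
    _ = 4 * |σ - s| ^ 3 / r ^ 3 + 4 * |s| ^ 3 / r ^ 3 := by ring
    _ ≤ _ := add_le_add h2 h3

/-- Inner-zone algebra (3): `|σ|/r² ≤ 1/(2a) + |s|/ψ`. [folklore] -/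
theorem inner_zone_b3 {a s σ r : ℝ} (ha : 0 < a) (hr : 0 < r) (hψr : a ^ 2 + (σ - s) ^ 2 ≤ r ^ 2) :
    |σ| / r ^ 2 ≤ 1 / (2 * a) + |s| * (a ^ 2 + (σ - s) ^ 2)⁻¹ := by
  have hψ0 : 0 < a ^ 2 + (σ - s) ^ 2 := by positivity
  have hr2 : 0 < r ^ 2 := by positivity
  have hσabs : |σ| ≤ |σ - s| + |s| := by
    calc |σ| = |(σ - s) + s| := by rw [sub_add_cancel]
      _ ≤ |σ - s| + |s| := abs_add_le _ _
  have hamgm : |σ - s| / (a ^ 2 + (σ - s) ^ 2) ≤ 1 / (2 * a) := by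
    rw [div_le_div_iff₀ hψ0 (by positivity), one_mul]
    nlinarith [sq_nonneg (|σ - s| - a), sq_abs (σ - s)]
  have h2 : |s| / r ^ 2 ≤ |s| * (a ^ 2 + (σ - s) ^ 2)⁻¹ := by
    rw [← div_eq_mul_inv]; exact div_le_div_of_nonneg_left (abs_nonneg s) hψ0 hψr
  have h1 : |σ - s| / r ^ 2 ≤ |σ - s| / (a ^ 2 + (σ - s) ^ 2) := div_le_div_of_nonneg_left (abs_nonneg _) hψ0 hψr
  calc |σ| / r ^ 2 ≤ (|σ - s| + |s|) / r ^ 2 := div_le_div_of_nonneg_right hσabs hr2.le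
    _ = |σ - s| / r ^ 2 + |s| / r ^ 2 := by ring
    _ ≤ _ := add_le_add (h1.trans hamgm) h2

/-- Inner-zone algebra (4): `σ²/r² ≤ 2 + 2s²/ψ`. [folklore] -/
theorem inner_zone_b4 {a s σ r : ℝ} (ha : 0 < a) (hr : 0 < r) (hψr : a ^ 2 + (σ - s) ^ 2 ≤ r ^ 2) :
    σ ^ 2 / r ^ 2 ≤ 2 + 2 * s ^ 2 * (a ^ 2 + (σ - s) ^ 2)⁻¹ := by
  have hψ0 : 0 < a ^ 2 + (σ - s) ^ 2 := by positivity
  have hr2 : 0 < r ^ 2 := by positivity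
  have hσ2 : σ ^ 2 ≤ 2 * (σ - s) ^ 2 + 2 * s ^ 2 := by nlinarith [sq_nonneg (σ - 2 * s)]
  have h1 : 2 * (σ - s) ^ 2 / r ^ 2 ≤ 2 := by
    rw [div_le_iff₀ hr2]; nlinarith [sq_nonneg a]
  have h2 : 2 * s ^ 2 / r ^ 2 ≤ 2 * s ^ 2 * (a ^ 2 + (σ - s) ^ 2)⁻¹ := by
    rw [← div_eq_mul_inv]; exact div_le_div_of_nonneg_left (by positivity) hψ0 hψr
  calc σ ^ 2 / r ^ 2 ≤ (2 * (σ - s) ^ 2 + 2 * s ^ 2) / r ^ 2 := div_le_div_of_nonneg_right hσ2 hr2.le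
    _ = 2 * (σ - s) ^ 2 / r ^ 2 + 2 * s ^ 2 / r ^ 2 := by ring
    _ ≤ _ := add_le_add h1 h2

/-- Inner-zone algebra: the four bounds packaged as the one inequality the envelope lemma needs. [folklore] -/
theorem inner_zone_majorant {a s σ r d₂ d₃ t₁ t₂ : ℝ} (ha : 0 < a) (hr : 0 < r) (hψr : a ^ 2 + (σ - s) ^ 2 ≤ r ^ 2)
    (hd₂ : 0 ≤ d₂) (hd₃ : 0 ≤ d₃) (ht₁ : 0 ≤ t₁) (ht₂ : 0 ≤ t₂) :
    25 * (d₂ * σ ^ 2 + d₃ * |σ| ^ 3) / r ^ 3 + 2 * (t₁ * |σ| + t₂ * σ ^ 2) / r ^ 2 ≤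
      (50 * d₂ / a + 100 * d₃ + t₁ / a + 4 * t₂) +
        (50 * d₂ * s ^ 2 / a + 100 * d₃ * |s| ^ 3 / a + 2 * t₁ * |s| + 4 * t₂ * s ^ 2) * (a ^ 2 + (σ - s) ^ 2)⁻¹ := by
  set ι := (a ^ 2 + (σ - s) ^ 2)⁻¹ with hι
  have c1 := mul_le_mul_of_nonneg_left (inner_zone_b1 ha hr hψr) (by positivity : (0:ℝ) ≤ 25 * d₂)
  have c2 := mul_le_mul_of_nonneg_left (inner_zone_b2 ha hr hψr) (by positivity : (0:ℝ) ≤ 25 * d₃)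
  have c3 := mul_le_mul_of_nonneg_left (inner_zone_b3 ha hr hψr) (by positivity : (0:ℝ) ≤ 2 * t₁)
  have c4 := mul_le_mul_of_nonneg_left (inner_zone_b4 ha hr hψr) (by positivity : (0:ℝ) ≤ 2 * t₂)
  rw [← hι] at c1 c2 c3 c4
  have e1 : 25 * (d₂ * σ ^ 2 + d₃ * |σ| ^ 3) / r ^ 3 = 25 * d₂ * (σ ^ 2 / r ^ 3) + 25 * d₃ * (|σ| ^ 3 / r ^ 3) := by ring
  have e2 : 2 * (t₁ * |σ| + t₂ * σ ^ 2) / r ^ 2 = 2 * t₁ * (|σ| / r ^ 2) + 2 * t₂ * (σ ^ 2 / r ^ 2) := by ring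
  have e3 : (50 * d₂ / a + 100 * d₃ + t₁ / a + 4 * t₂) +
      (50 * d₂ * s ^ 2 / a + 100 * d₃ * |s| ^ 3 / a + 2 * t₁ * |s| + 4 * t₂ * s ^ 2) * ι =
      25 * d₂ * (2 / a + 2 * s ^ 2 / a * ι) + 25 * d₃ * (4 + 4 * |s| ^ 3 / a * ι) +
        2 * t₁ * (1 / (2 * a) + |s| * ι) + 2 * t₂ * (2 + 2 * s ^ 2 * ι) := by
    field_simp
    ring
  rw [e1, e2, e3]
  linarith

/-- Outer-zone algebra: for `|σ| > Lk ≥ 2|s|`, `Lk > 0`, `0 ≤ θ`, and `r ≥ |σ − s|`: `25θ|σ|/r³ + 2θ/r² ≤ 416θ·(Lk² + σ²)⁻¹`. [folklore] -/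
theorem outer_zone_majorant {s σ Lk θ r : ℝ} (hLk : 0 < Lk) (hLs : 2 * |s| ≤ Lk) (hθ : 0 ≤ θ) (hσ : Lk < |σ|) (hr : |σ - s| ≤ r) :
    25 * (θ * |σ|) / r ^ 3 + 2 * θ / r ^ 2 ≤ 416 * θ * (Lk ^ 2 + (σ - 0) ^ 2)⁻¹ := by
  have hσ0 : 0 < |σ| := hLk.trans hσ
  have hhalf : |σ| / 2 ≤ r := by
    have h1 : |σ| - |s| ≤ |σ - s| := abs_sub_abs_le_abs_sub σ s
    linarith
  have hr0 : 0 < r := lt_of_lt_of_le (by positivity) hhalf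
  have hr2 : 0 < r ^ 2 := pow_pos hr0 2
  have hr3 : 0 < r ^ 3 := pow_pos hr0 3
  rw [sub_zero]
  have hσ2 : 0 < |σ| ^ 2 := by positivity
  set v : ℝ := θ / |σ| ^ 2 with hv
  have h3 : (|σ| / 2) ^ 3 ≤ r ^ 3 := pow_le_pow_left₀ (by positivity) hhalf 3
  have h2 : (|σ| / 2) ^ 2 ≤ r ^ 2 := pow_le_pow_left₀ (by positivity) hhalf 2
  have t1 : 25 * (θ * |σ|) / r ^ 3 ≤ 200 * v := by
    rw [hv, show 200 * (θ / |σ| ^ 2) = 200 * θ / |σ| ^ 2 by ring, div_le_div_iff₀ hr3 hσ2]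
    have : 25 * (θ * |σ|) * |σ| ^ 2 = 200 * θ * (|σ| / 2) ^ 3 := by ring
    rw [this]
    exact mul_le_mul_of_nonneg_left h3 (by positivity)
  have t2 : 2 * θ / r ^ 2 ≤ 8 * v := by
    rw [hv, show 8 * (θ / |σ| ^ 2) = 8 * θ / |σ| ^ 2 by ring, div_le_div_iff₀ hr2 hσ2]
    have : 2 * θ * |σ| ^ 2 = 8 * θ * (|σ| / 2) ^ 2 := by ring
    rw [this]
    exact mul_le_mul_of_nonneg_left h2 (by positivity)
  have t3 : 208 * v ≤ 416 * θ * (Lk ^ 2 + σ ^ 2)⁻¹ := by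
    have hL2 : Lk ^ 2 ≤ |σ| ^ 2 := pow_le_pow_left₀ hLk.le hσ.le 2
    have hsum : Lk ^ 2 + σ ^ 2 ≤ 2 * |σ| ^ 2 := by rw [sq_abs] at hL2 ⊢; linarith
    have hsum0 : 0 < Lk ^ 2 + σ ^ 2 := by positivity
    have hinv : 1 / (2 * |σ| ^ 2) ≤ (Lk ^ 2 + σ ^ 2)⁻¹ := by
      rw [← one_div]; exact one_div_le_one_div_of_le hsum0 hsum
    calc 208 * v = 416 * θ * (1 / (2 * |σ| ^ 2)) := by rw [hv]; field_simp; ring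
      _ ≤ 416 * θ * (Lk ^ 2 + σ ^ 2)⁻¹ := mul_le_mul_of_nonneg_left hinv (by positivity)
  linarith

/-! ## §2 The integrated mismatch with polynomial envelopes -/

/-- **Integrated kernel mismatch for one partner, polynomial envelopes (RATE B).**  See the module docstring. [folklore] -/
theorem norm_integral_kernelCross_sub_le_of_envelopes (e : ℝ) {L x : ℝ → EuclideanSpace ℝ (Fin 3)} {y t : EuclideanSpace ℝ (Fin 3)}
    {a s d₂ d₃ t₁ t₂ θ Lk : ℝ} (ha : 0 < a) (hd₂ : 0 ≤ d₂) (hd₃ : 0 ≤ d₃) (ht₁ : 0 ≤ t₁) (ht₂ : 0 ≤ t₂) (hθ : 0 ≤ θ) (ht : ‖t‖ = 1)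
    (hLk : 0 < Lk) (hLs : 2 * |s| ≤ Lk)
    (hline : ∀ σ, a ^ 2 + (σ - s) ^ 2 ≤ ‖y - L σ‖ ^ 2)
    (hdisp : ∀ σ, ‖x σ - L σ‖ ≤ d₂ * σ ^ 2 + d₃ * |σ| ^ 3) (hdispθ : ∀ σ, ‖x σ - L σ‖ ≤ θ * |σ|)
    (htilt : ∀ σ, ‖deriv x σ - t‖ ≤ t₁ * |σ| + t₂ * σ ^ 2) (htiltθ : ∀ σ, ‖deriv x σ - t‖ ≤ θ)
    (hsmall : ∀ σ, ‖x σ - L σ‖ ≤ ‖y - L σ‖ / 5) (hunit : ∀ σ, ‖deriv x σ‖ ≤ 1)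
    (hintA : Integrable fun σ : ℝ => ((‖y - x σ‖ ^ 2 + e ^ 2) ^ (3 / 2 : ℝ))⁻¹ • cross (deriv x σ) (y - x σ))
    (hintB : Integrable fun σ : ℝ => ((‖y - L σ‖ ^ 2 + e ^ 2) ^ (3 / 2 : ℝ))⁻¹ • cross t (y - L σ)) :
    ‖∫ σ : ℝ, (((‖y - x σ‖ ^ 2 + e ^ 2) ^ (3 / 2 : ℝ))⁻¹ • cross (deriv x σ) (y - x σ) -
        ((‖y - L σ‖ ^ 2 + e ^ 2) ^ (3 / 2 : ℝ))⁻¹ • cross t (y - L σ))‖ ≤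
      2 * Lk * (50 * d₂ / a + 100 * d₃ + t₁ / a + 4 * t₂) +
        (50 * d₂ * s ^ 2 / a + 100 * d₃ * |s| ^ 3 / a + 2 * t₁ * |s| + 4 * t₂ * s ^ 2) * (Real.pi / a) +
        416 * θ * (Real.pi / Lk) := by
  set A₀ : ℝ := 50 * d₂ / a + 100 * d₃ + t₁ / a + 4 * t₂ with hA₀
  set A₁ : ℝ := 50 * d₂ * s ^ 2 / a + 100 * d₃ * |s| ^ 3 / a + 2 * t₁ * |s| + 4 * t₂ * s ^ 2 with hA₁
  have hA₀0 : 0 ≤ A₀ := by positivity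
  have hA₁0 : 0 ≤ A₁ := by positivity
  set F : ℝ → EuclideanSpace ℝ (Fin 3) := fun σ => ((‖y - x σ‖ ^ 2 + e ^ 2) ^ (3 / 2 : ℝ))⁻¹ • cross (deriv x σ) (y - x σ) -
    ((‖y - L σ‖ ^ 2 + e ^ 2) ^ (3 / 2 : ℝ))⁻¹ • cross t (y - L σ) with hF
  -- the majorant
  set m₁ : ℝ → ℝ := (Icc (-Lk) Lk).indicator fun σ => A₀ + A₁ * (a ^ 2 + (σ - s) ^ 2)⁻¹ with hm₁
  set m₂ : ℝ → ℝ := fun σ => 416 * θ * (Lk ^ 2 + (σ - 0) ^ 2)⁻¹ with hm₂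
  have hm₁0 : ∀ σ, 0 ≤ m₁ σ := fun σ => by rw [hm₁]; exact Set.indicator_nonneg (fun z _ => by positivity) σ
  have hm₂0 : ∀ σ, 0 ≤ m₂ σ := fun σ => by rw [hm₂]; positivity
  have hψc : Continuous fun σ : ℝ => (a ^ 2 + (σ - s) ^ 2)⁻¹ := by
    have hf : Continuous fun σ : ℝ => a ^ 2 + (σ - s) ^ 2 := by fun_prop
    exact hf.inv₀ fun σ => (by positivity : (0:ℝ) < a ^ 2 + (σ - s) ^ 2).ne'
  have hI₁ : Integrable m₁ := ((continuous_const.add (continuous_const.mul hψc)).integrableOn_Icc).integrable_indicator measurableSet_Icc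
  have hI₂ : Integrable m₂ := (integrable_inv_sq_add_sq hLk 0).const_mul _
  -- pointwise
  have hmaj : ∀ σ, ‖F σ‖ ≤ m₁ σ + m₂ σ := by
    intro σ
    set r := ‖y - L σ‖ with hr
    have hq : 0 < a ^ 2 + (σ - s) ^ 2 := by positivity
    have hr2 : a ^ 2 + (σ - s) ^ 2 ≤ r ^ 2 := hline σ
    have hrpos : 0 < r := by
      by_contra h
      have h0 : r = 0 := le_antisymm (not_lt.1 h) (by rw [hr]; exact norm_nonneg _)
      rw [h0] at hr2; nlinarith [sq_nonneg (σ - s)]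
    have hus : |σ - s| ≤ r := by
      have h := Real.sqrt_le_sqrt (show (σ - s) ^ 2 ≤ r ^ 2 by nlinarith)
      rwa [Real.sqrt_sq_eq_abs, Real.sqrt_sq hrpos.le] at h
    have hxD : x σ = L σ + (x σ - L σ) := by abel
    by_cases hin : |σ| ≤ Lk
    · -- inner zone: pointwise lemma with the polynomial weights, then the algebra
      have hpt := norm_kernelCross_sub_le e (y := y) (L := L σ) (D := x σ - L σ) (t := t) (x' := deriv x σ) hrpos (hsmall σ) ht
        (hunit σ) (htilt σ)
      rw [← hxD] at hpt
      have hmem : σ ∈ Icc (-Lk) Lk := ⟨by linarith [neg_abs_le σ, hin], (le_abs_self σ).trans hin⟩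
      have hm₁σ : m₁ σ = A₀ + A₁ * (a ^ 2 + (σ - s) ^ 2)⁻¹ := by rw [hm₁, Set.indicator_of_mem hmem]
      have hD3 : 25 * ‖x σ - L σ‖ / r ^ 3 ≤ 25 * (d₂ * σ ^ 2 + d₃ * |σ| ^ 3) / r ^ 3 := by
        gcongr; exact hdisp σ
      have halg := inner_zone_majorant (s := s) (σ := σ) ha hrpos hr2 hd₂ hd₃ ht₁ ht₂
      calc ‖F σ‖ ≤ 25 * ‖x σ - L σ‖ / r ^ 3 + 2 * (t₁ * |σ| + t₂ * σ ^ 2) / r ^ 2 := hpt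
        _ ≤ A₀ + A₁ * (a ^ 2 + (σ - s) ^ 2)⁻¹ := by linarith
        _ = m₁ σ := hm₁σ.symm
        _ ≤ m₁ σ + m₂ σ := by linarith [hm₂0 σ]
    · -- outer zone: constant tilt, linear displacement
      push Not at hin
      have hpt := norm_kernelCross_sub_le e (y := y) (L := L σ) (D := x σ - L σ) (t := t) (x' := deriv x σ) hrpos (hsmall σ) ht
        (hunit σ) (htiltθ σ)
      rw [← hxD] at hpt
      have hD3 : 25 * ‖x σ - L σ‖ / r ^ 3 ≤ 25 * (θ * |σ|) / r ^ 3 := by gcongr; exact hdispθ σ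
      have halg := outer_zone_majorant hLk hLs hθ hin hus
      calc ‖F σ‖ ≤ 25 * ‖x σ - L σ‖ / r ^ 3 + 2 * θ / r ^ 2 := hpt
        _ ≤ 25 * (θ * |σ|) / r ^ 3 + 2 * θ / r ^ 2 := by linarith
        _ ≤ m₂ σ := halg
        _ ≤ m₁ σ + m₂ σ := by linarith [hm₁0 σ]
  -- integrate
  have hFint : Integrable F := hintA.sub hintB
  have hmain : ‖∫ σ, F σ‖ ≤ ∫ σ, (m₁ σ + m₂ σ) :=
    norm_integral_le_of_norm_le (hI₁.add hI₂) (Eventually.of_forall hmaj)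
  have hv₁ : ∫ σ, m₁ σ ≤ 2 * Lk * A₀ + A₁ * (Real.pi / a) := by
    rw [hm₁, MeasureTheory.integral_indicator measurableSet_Icc]
    have hsplit : ∫ σ in Icc (-Lk) Lk, (A₀ + A₁ * (a ^ 2 + (σ - s) ^ 2)⁻¹) =
        (∫ σ in Icc (-Lk) Lk, A₀) + ∫ σ in Icc (-Lk) Lk, A₁ * (a ^ 2 + (σ - s) ^ 2)⁻¹ := by
      refine integral_add (integrableOn_const (by simp)) ?_
      exact ((continuous_const.mul hψc).integrableOn_Icc)
    rw [hsplit]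
    have h1 : ∫ σ in Icc (-Lk) Lk, A₀ = 2 * Lk * A₀ := by
      rw [setIntegral_const, Real.volume_real_Icc_of_le (by linarith), smul_eq_mul]; ring
    have h2 : ∫ σ in Icc (-Lk) Lk, A₁ * (a ^ 2 + (σ - s) ^ 2)⁻¹ ≤ A₁ * (Real.pi / a) := by
      rw [integral_const_mul, ← integral_inv_sq_add_sq ha s]
      refine mul_le_mul_of_nonneg_left ?_ hA₁0
      exact setIntegral_le_integral (integrable_inv_sq_add_sq ha s) (Eventually.of_forall fun σ => by positivity)
    linarith
  have hv₂ : ∫ σ, m₂ σ = 416 * θ * (Real.pi / Lk) := by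
    rw [hm₂, integral_const_mul, integral_inv_sq_add_sq hLk 0]
  calc ‖∫ σ, F σ‖ ≤ ∫ σ, (m₁ σ + m₂ σ) := hmain
    _ = (∫ σ, m₁ σ) + ∫ σ, m₂ σ := integral_add hI₁ hI₂
    _ ≤ 2 * Lk * A₀ + A₁ * (Real.pi / a) + 416 * θ * (Real.pi / Lk) := by rw [hv₂]; linarith

end Summit.NavierStokesRegularity.NavierStokesRegularity.Theorems.SkeletonJ1RMismatchTools

end
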